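import Mathlib
import Summits.Ventures.PercRepro2.V2SP
import Summits.Ventures.PercRepro2.HallOffFrame
import Summits.Ventures.PercRepro2.HallOffAxis
import Summits.Ventures.PercRepro2.Tail2DCount
import Summits.Ventures.PercRepro2.Tail2DThreePoint
import Summits.Ventures.PercRepro2.Tail2DP2Series
import Summits.Ventures.PercRepro2.Tail2DDisjointPaths
import Summits.Ventures.PercRepro2.Tail2DP2SeriesSP
import Summits.Ventures.PercRepro2.Tail2DAxisUnimodal
import Summits.Ventures.PercRepro2.Tail2DOffAxis31
import Summits.Ventures.PercRepro2.Tail2DRowOne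
import Summits.Ventures.PercRepro2.Tail2DStepRowZero
import Summits.Ventures.PercRepro2.Tail2DStepCert
import Summits.Ventures.PercRepro2.Tail2DOffAxisCert
import Summits.Ventures.PercRepro2.Tail2DStepFour
import Summits.Ventures.PercRepro2.Tail2DStepFive
import Summits.Ventures.PercRepro2.Tail2DOffAxisSix
import Summits.Ventures.PercRepro2.Tail2DOffAxisSeven
import Summits.Ventures.PercRepro2.Tail2DOffAxisEight
import Summits.Ventures.PercRepro2.Tail2DOffAxisNine
import Summits.Ventures.PercRepro2.Tail2DColTwoCert
import Summits.Ventures.PercRepro2.Tail2DColTwo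
import Summits.Ventures.PercRepro2.Tail2DColThreeCert
import Summits.Ventures.PercRepro2.Tail2DColThreeSumA
import Summits.Ventures.PercRepro2.Tail2DColThreeSumB

/-!
# The whole column `j = 3` of the off-axis family: `T(a,3) ≤ T(a−1,4)` for EVERY `a ≥ 5` on every
series–parallel network (seat mine-b, cell pub-perc-repro2; MINE-B.md §38)

For every pattern `s` of the cell's grammar, uniformly two-coloured, and every `a ≥ 5`,
`#{r ≥ a ∧ b ≥ 3} ≤ #{r ≥ a−1 ∧ b ≥ 4}` (`t_col3`): `a` edge-disjoint red paths together with `3`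
edge-disjoint blue paths are rarer than `a−1` red paths together with `4` blue paths — the column `j = 3`
of the anti-diagonal unimodality `T(a, j) ≤ T(a−1, j+1)`.  The parallel step (`sum_phi_col3_par`) sums the
pointwise certificate `phi_col3_par_ge` of `Tail2DColThreeCert.lean` over the product of the configuration spaces
(`sum_prod_wt_fst/snd` with the level of the hypothesis depending on the label of the other factor,
`sum_mul_prod_nonneg` for products of two hypotheses, `sum_antisymm_zero` for the swap differences); series
multiplies both tails (`card_tail_ser`); the atoms have flows `≤ 1`; the members `a < 10` are the landed ones.
-/

namespace Summit.Ventures.PercRepro2.Tail2D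

open V2Closure

section Product

variable (s t : V2Closure.SP)

/-- **the parallel step of the column `j = 3`** (`a ≥ 10`): if the counts of `phi m 3` are non-negative on
both factors for `5 ≤ m ≤ a`, the count of `phi a 3` is non-negative on the parallel composition -/
theorem sum_phi_col3_par (a : ℕ) (ha : 10 ≤ a)
    (hs3 : ∀ m, 5 ≤ m → m ≤ a → 0 ≤ ∑ x, phi m 3 (s.rLab x) (s.bLab x))
    (ht3 : ∀ m, 5 ≤ m → m ≤ a → 0 ≤ ∑ y, phi m 3 (t.rLab y) (t.bLab y)) :
    0 ≤ ∑ p, phi a 3 ((V2Closure.SP.par s t).rLab p) ((V2Closure.SP.par s t).bLab p) := by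
  have g0 := sum_col3_grpA s t a ha hs3 ht3
  have g1 := sum_col3_grpB s t a ha hs3 ht3
  have key : ∀ p : s.Conf × t.Conf,
        ((if (s.bLab p.1) = 1 ∧ 6 ≤ (s.rLab p.1) then (1 : ℤ) else 0) - (if (s.rLab p.1) = 1 ∧ 6 ≤ (s.bLab p.1) then (1 : ℤ) else 0)) * phi (a - 4) 2 (t.rLab p.2) (t.bLab p.2)
      + (2 : ℤ) * (((if (s.bLab p.1) = 2 ∧ 6 ≤ (s.rLab p.1) then (1 : ℤ) else 0) - (if (s.rLab p.1) = 2 ∧ 6 ≤ (s.bLab p.1) then (1 : ℤ) else 0)) * phi (a - 3) 1 (t.rLab p.2) (t.bLab p.2))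
      + (2 : ℤ) * (((if (s.bLab p.1) = 3 ∧ 6 ≤ (s.rLab p.1) then (1 : ℤ) else 0) - (if (s.rLab p.1) = 3 ∧ 6 ≤ (s.bLab p.1) then (1 : ℤ) else 0)) * phi (a - 4) 0 (t.rLab p.2) (t.bLab p.2))
      + (5 : ℤ) * (((if (s.bLab p.1) = 0 ∧ 5 ≤ (s.rLab p.1) then (1 : ℤ) else 0) - (if (s.rLab p.1) = 0 ∧ 5 ≤ (s.bLab p.1) then (1 : ℤ) else 0)) * ((if 2 ≤ (t.rLab p.2) ∧ 4 ≤ (t.bLab p.2) then (1 : ℤ) else 0) - (if 2 ≤ (t.bLab p.2) ∧ 4 ≤ (t.rLab p.2) then (1 : ℤ) else 0)))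
      + (2 : ℤ) * (((if (s.bLab p.1) = 2 ∧ 3 ≤ (s.rLab p.1) then (1 : ℤ) else 0) - (if (s.rLab p.1) = 2 ∧ 3 ≤ (s.bLab p.1) then (1 : ℤ) else 0)) * phi (a - 3) 1 (t.rLab p.2) (t.bLab p.2))
      + (4 : ℤ) * ((if (t.rLab p.2) + 4 = a ∧ (t.bLab p.2) = 0 then (1 : ℤ) else 0) * ((if (s.bLab p.1) = 2 ∧ 4 ≤ (s.rLab p.1) then (1 : ℤ) else 0) - (if (s.rLab p.1) = 2 ∧ 4 ≤ (s.bLab p.1) then (1 : ℤ) else 0)))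
      + (4 : ℤ) * (((if 2 ≤ (s.bLab p.1) ∧ 4 ≤ (s.rLab p.1) then (1 : ℤ) else 0) - (if 2 ≤ (s.rLab p.1) ∧ 4 ≤ (s.bLab p.1) then (1 : ℤ) else 0)) * ((if (t.rLab p.2) = 0 ∧ 5 ≤ (t.bLab p.2) then (1 : ℤ) else 0) - (if (t.bLab p.2) = 0 ∧ 5 ≤ (t.rLab p.2) then (1 : ℤ) else 0)))
      + (4 : ℤ) * ((if 5 ≤ (t.rLab p.2) ∧ (t.rLab p.2) + 5 ≤ a ∧ (t.bLab p.2) = 0 then (1 : ℤ) else 0) * ((if 2 ≤ (s.bLab p.1) ∧ 4 ≤ (s.rLab p.1) then (1 : ℤ) else 0) - (if 2 ≤ (s.rLab p.1) ∧ 4 ≤ (s.bLab p.1) then (1 : ℤ) else 0)))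
      + (4 : ℤ) * ((if (t.rLab p.2) = 0 ∧ (t.bLab p.2) = 5 then (1 : ℤ) else 0) * ((if 2 ≤ (s.rLab p.1) ∧ 4 ≤ (s.bLab p.1) then (1 : ℤ) else 0) - (if 2 ≤ (s.bLab p.1) ∧ 4 ≤ (s.rLab p.1) then (1 : ℤ) else 0)))
      + (4 : ℤ) * ((if (t.rLab p.2) = 0 ∧ 6 ≤ (t.bLab p.2) then (1 : ℤ) else 0) * ((if 2 ≤ (s.rLab p.1) ∧ 4 ≤ (s.bLab p.1) then (1 : ℤ) else 0) - (if 2 ≤ (s.bLab p.1) ∧ 4 ≤ (s.rLab p.1) then (1 : ℤ) else 0)))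
      + (6 : ℤ) * ((if 5 ≤ (s.rLab p.1) ∧ (s.rLab p.1) + 5 ≤ a ∧ (s.bLab p.1) = 0 then (1 : ℤ) else 0) * phi (a - (s.rLab p.1)) 3 (t.rLab p.2) (t.bLab p.2))
      + (5 : ℤ) * ((if 5 ≤ (s.rLab p.1) ∧ (s.rLab p.1) + 5 ≤ a ∧ (s.bLab p.1) = 1 then (1 : ℤ) else 0) * phi (a - (s.rLab p.1)) 2 (t.rLab p.2) (t.bLab p.2))
      + (if 5 ≤ (s.rLab p.1) ∧ (s.rLab p.1) + 5 ≤ a ∧ (s.bLab p.1) = 1 then (1 : ℤ) else 0) * phi (a - (s.rLab p.1) + 1) 2 (t.rLab p.2) (t.bLab p.2)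
      + (if 5 ≤ (s.rLab p.1) ∧ (s.rLab p.1) + 5 ≤ a ∧ (s.bLab p.1) = 1 then (1 : ℤ) else 0) * phi (a - (s.rLab p.1)) 3 (t.rLab p.2) (t.bLab p.2)
      + (4 : ℤ) * ((if 5 ≤ (s.rLab p.1) ∧ (s.rLab p.1) + 5 ≤ a ∧ (s.bLab p.1) = 2 then (1 : ℤ) else 0) * phi (a - (s.rLab p.1)) 1 (t.rLab p.2) (t.bLab p.2))
      + (if 5 ≤ (s.rLab p.1) ∧ (s.rLab p.1) + 5 ≤ a ∧ (s.bLab p.1) = 2 then (1 : ℤ) else 0) * phi (a - (s.rLab p.1)) 3 (t.rLab p.2) (t.bLab p.2)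
      + (2 : ℤ) * ((if 5 ≤ (s.rLab p.1) ∧ (s.rLab p.1) + 5 ≤ a ∧ (s.bLab p.1) = 3 then (1 : ℤ) else 0) * phi (a - (s.rLab p.1) + 1) 0 (t.rLab p.2) (t.bLab p.2))
      + (2 : ℤ) * ((if 5 ≤ (s.rLab p.1) ∧ (s.rLab p.1) + 5 ≤ a ∧ (s.bLab p.1) = 3 then (1 : ℤ) else 0) * phi (a - (s.rLab p.1)) 1 (t.rLab p.2) (t.bLab p.2))
      + (if 5 ≤ (s.rLab p.1) ∧ (s.rLab p.1) + 5 ≤ a ∧ (s.bLab p.1) = 3 then (1 : ℤ) else 0) * phi (a - (s.rLab p.1)) 3 (t.rLab p.2) (t.bLab p.2)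
      + (2 : ℤ) * ((if 5 ≤ (s.rLab p.1) ∧ (s.rLab p.1) + 5 ≤ a ∧ (s.bLab p.1) = 4 then (1 : ℤ) else 0) * phi (a - (s.rLab p.1)) 1 (t.rLab p.2) (t.bLab p.2))
      + (if 5 ≤ (s.rLab p.1) ∧ (s.rLab p.1) + 5 ≤ a ∧ (s.bLab p.1) = 4 then (1 : ℤ) else 0) * phi (a - (s.rLab p.1)) 3 (t.rLab p.2) (t.bLab p.2)
      + (2 : ℤ) * ((if 5 ≤ (s.rLab p.1) ∧ (s.rLab p.1) + 5 ≤ a ∧ (s.bLab p.1) = 5 then (1 : ℤ) else 0) * phi (a - (s.rLab p.1)) 1 (t.rLab p.2) (t.bLab p.2))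
      + (if 5 ≤ (s.rLab p.1) ∧ (s.rLab p.1) + 5 ≤ a ∧ (s.bLab p.1) = 5 then (1 : ℤ) else 0) * phi (a - (s.rLab p.1)) 3 (t.rLab p.2) (t.bLab p.2)
      + (2 : ℤ) * ((if 5 ≤ (s.rLab p.1) ∧ (s.rLab p.1) + 5 ≤ a ∧ 6 ≤ (s.bLab p.1) then (1 : ℤ) else 0) * phi (a - (s.rLab p.1)) 1 (t.rLab p.2) (t.bLab p.2))
      + (if 5 ≤ (s.rLab p.1) ∧ (s.rLab p.1) + 5 ≤ a ∧ 6 ≤ (s.bLab p.1) then (1 : ℤ) else 0) * phi (a - (s.rLab p.1)) 3 (t.rLab p.2) (t.bLab p.2)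
      + (6 : ℤ) * ((if 5 ≤ (t.rLab p.2) ∧ (t.rLab p.2) + 5 ≤ a ∧ (t.bLab p.2) = 0 then (1 : ℤ) else 0) * phi (a - (t.rLab p.2)) 3 (s.rLab p.1) (s.bLab p.1))
      + (4 : ℤ) * ((if 5 ≤ (t.rLab p.2) ∧ (t.rLab p.2) + 5 ≤ a ∧ (t.bLab p.2) = 1 then (1 : ℤ) else 0) * phi (a - (t.rLab p.2)) 2 (s.rLab p.1) (s.bLab p.1))
      + (2 : ℤ) * ((if 5 ≤ (t.rLab p.2) ∧ (t.rLab p.2) + 5 ≤ a ∧ (t.bLab p.2) = 1 then (1 : ℤ) else 0) * phi (a - (t.rLab p.2) + 1) 2 (s.rLab p.1) (s.bLab p.1))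
      + (2 : ℤ) * ((if 5 ≤ (t.rLab p.2) ∧ (t.rLab p.2) + 5 ≤ a ∧ (t.bLab p.2) = 1 then (1 : ℤ) else 0) * phi (a - (t.rLab p.2)) 3 (s.rLab p.1) (s.bLab p.1))
      + (2 : ℤ) * ((if 5 ≤ (t.rLab p.2) ∧ (t.rLab p.2) + 5 ≤ a ∧ (t.bLab p.2) = 2 then (1 : ℤ) else 0) * phi (a - (t.rLab p.2)) 1 (s.rLab p.1) (s.bLab p.1))
      + (2 : ℤ) * ((if 5 ≤ (t.rLab p.2) ∧ (t.rLab p.2) + 5 ≤ a ∧ (t.bLab p.2) = 2 then (1 : ℤ) else 0) * phi (a - (t.rLab p.2)) 3 (s.rLab p.1) (s.bLab p.1))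
      + (if 5 ≤ (t.rLab p.2) ∧ (t.rLab p.2) + 5 ≤ a ∧ (t.bLab p.2) = 3 then (1 : ℤ) else 0) * phi (a - (t.rLab p.2) + 1) 0 (s.rLab p.1) (s.bLab p.1)
      + (if 5 ≤ (t.rLab p.2) ∧ (t.rLab p.2) + 5 ≤ a ∧ (t.bLab p.2) = 3 then (1 : ℤ) else 0) * phi (a - (t.rLab p.2)) 1 (s.rLab p.1) (s.bLab p.1)
      + (2 : ℤ) * ((if 5 ≤ (t.rLab p.2) ∧ (t.rLab p.2) + 5 ≤ a ∧ (t.bLab p.2) = 3 then (1 : ℤ) else 0) * phi (a - (t.rLab p.2)) 3 (s.rLab p.1) (s.bLab p.1))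
      + (if 5 ≤ (t.rLab p.2) ∧ (t.rLab p.2) + 5 ≤ a ∧ (t.bLab p.2) = 4 then (1 : ℤ) else 0) * phi (a - (t.rLab p.2)) 1 (s.rLab p.1) (s.bLab p.1)
      + (2 : ℤ) * ((if 5 ≤ (t.rLab p.2) ∧ (t.rLab p.2) + 5 ≤ a ∧ (t.bLab p.2) = 4 then (1 : ℤ) else 0) * phi (a - (t.rLab p.2)) 3 (s.rLab p.1) (s.bLab p.1))
      + (if 5 ≤ (t.rLab p.2) ∧ (t.rLab p.2) + 5 ≤ a ∧ (t.bLab p.2) = 5 then (1 : ℤ) else 0) * phi (a - (t.rLab p.2)) 1 (s.rLab p.1) (s.bLab p.1)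
      + (2 : ℤ) * ((if 5 ≤ (t.rLab p.2) ∧ (t.rLab p.2) + 5 ≤ a ∧ (t.bLab p.2) = 5 then (1 : ℤ) else 0) * phi (a - (t.rLab p.2)) 3 (s.rLab p.1) (s.bLab p.1))
      + (if 5 ≤ (t.rLab p.2) ∧ (t.rLab p.2) + 5 ≤ a ∧ 6 ≤ (t.bLab p.2) then (1 : ℤ) else 0) * phi (a - (t.rLab p.2)) 1 (s.rLab p.1) (s.bLab p.1)
      + (2 : ℤ) * ((if 5 ≤ (t.rLab p.2) ∧ (t.rLab p.2) + 5 ≤ a ∧ 6 ≤ (t.bLab p.2) then (1 : ℤ) else 0) * phi (a - (t.rLab p.2)) 3 (s.rLab p.1) (s.bLab p.1))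
      + (6 : ℤ) * ((if (s.rLab p.1) = 0 ∧ (s.bLab p.1) = 0 then (1 : ℤ) else 0) * phi a 3 (t.rLab p.2) (t.bLab p.2))
      + (6 : ℤ) * ((if (s.rLab p.1) = 0 ∧ (s.bLab p.1) = 1 then (1 : ℤ) else 0) * phi a 2 (t.rLab p.2) (t.bLab p.2))
      + (6 : ℤ) * ((if (s.rLab p.1) = 0 ∧ (s.bLab p.1) = 2 then (1 : ℤ) else 0) * phi a 1 (t.rLab p.2) (t.bLab p.2))
      + (6 : ℤ) * ((if (s.rLab p.1) = 0 ∧ (s.bLab p.1) = 3 then (1 : ℤ) else 0) * phi a 0 (t.rLab p.2) (t.bLab p.2))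
      + (5 : ℤ) * ((if (s.rLab p.1) = 0 ∧ (s.bLab p.1) = 5 then (1 : ℤ) else 0) * ((if 2 ≤ (t.rLab p.2) ∧ 4 ≤ (t.bLab p.2) then (1 : ℤ) else 0) - (if 2 ≤ (t.bLab p.2) ∧ 4 ≤ (t.rLab p.2) then (1 : ℤ) else 0)))
      + (5 : ℤ) * ((if (s.rLab p.1) = 0 ∧ 6 ≤ (s.bLab p.1) then (1 : ℤ) else 0) * ((if 2 ≤ (t.rLab p.2) ∧ 4 ≤ (t.bLab p.2) then (1 : ℤ) else 0) - (if 2 ≤ (t.bLab p.2) ∧ 4 ≤ (t.rLab p.2) then (1 : ℤ) else 0)))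
      + (6 : ℤ) * ((if (s.rLab p.1) = 1 ∧ (s.bLab p.1) = 0 then (1 : ℤ) else 0) * phi (a - 1) 3 (t.rLab p.2) (t.bLab p.2))
      + (6 : ℤ) * ((if (s.rLab p.1) = 1 ∧ (s.bLab p.1) = 1 then (1 : ℤ) else 0) * phi (a - 1) 2 (t.rLab p.2) (t.bLab p.2))
      + (6 : ℤ) * ((if (s.rLab p.1) = 1 ∧ (s.bLab p.1) = 2 then (1 : ℤ) else 0) * phi (a - 1) 1 (t.rLab p.2) (t.bLab p.2))
      + (6 : ℤ) * ((if (s.rLab p.1) = 1 ∧ (s.bLab p.1) = 3 then (1 : ℤ) else 0) * phi (a - 1) 0 (t.rLab p.2) (t.bLab p.2))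
      + (if (s.rLab p.1) = 1 ∧ 6 ≤ (s.bLab p.1) then (1 : ℤ) else 0) * phi (a - 4) 2 (t.rLab p.2) (t.bLab p.2)
      + (6 : ℤ) * ((if (s.rLab p.1) = 2 ∧ (s.bLab p.1) = 0 then (1 : ℤ) else 0) * phi (a - 2) 3 (t.rLab p.2) (t.bLab p.2))
      + (6 : ℤ) * ((if (s.rLab p.1) = 2 ∧ (s.bLab p.1) = 1 then (1 : ℤ) else 0) * phi (a - 2) 2 (t.rLab p.2) (t.bLab p.2))
      + (6 : ℤ) * ((if (s.rLab p.1) = 2 ∧ (s.bLab p.1) = 2 then (1 : ℤ) else 0) * phi (a - 2) 1 (t.rLab p.2) (t.bLab p.2))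
      + (6 : ℤ) * ((if (s.rLab p.1) = 2 ∧ (s.bLab p.1) = 3 then (1 : ℤ) else 0) * phi (a - 2) 0 (t.rLab p.2) (t.bLab p.2))
      + (2 : ℤ) * ((if (s.rLab p.1) = 2 ∧ (s.bLab p.1) = 3 then (1 : ℤ) else 0) * phi (a - 3) 1 (t.rLab p.2) (t.bLab p.2))
      + (4 : ℤ) * ((if (s.rLab p.1) = 2 ∧ (s.bLab p.1) = 4 then (1 : ℤ) else 0) * phi (a - 2) 0 (t.rLab p.2) (t.bLab p.2))
      + (2 : ℤ) * ((if (s.rLab p.1) = 2 ∧ (s.bLab p.1) = 4 then (1 : ℤ) else 0) * phi (a - 2) 1 (t.rLab p.2) (t.bLab p.2))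
      + (4 : ℤ) * ((if (s.rLab p.1) = 2 ∧ (s.bLab p.1) = 5 then (1 : ℤ) else 0) * phi (a - 2) 0 (t.rLab p.2) (t.bLab p.2))
      + (2 : ℤ) * ((if (s.rLab p.1) = 2 ∧ (s.bLab p.1) = 5 then (1 : ℤ) else 0) * phi (a - 2) 1 (t.rLab p.2) (t.bLab p.2))
      + (4 : ℤ) * ((if (s.rLab p.1) = 2 ∧ 6 ≤ (s.bLab p.1) then (1 : ℤ) else 0) * phi (a - 2) 0 (t.rLab p.2) (t.bLab p.2))
      + (2 : ℤ) * ((if (s.rLab p.1) = 2 ∧ 6 ≤ (s.bLab p.1) then (1 : ℤ) else 0) * phi (a - 2) 1 (t.rLab p.2) (t.bLab p.2))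
      + (2 : ℤ) * ((if (s.rLab p.1) = 2 ∧ 6 ≤ (s.bLab p.1) then (1 : ℤ) else 0) * phi (a - 3) 1 (t.rLab p.2) (t.bLab p.2))
      + (6 : ℤ) * ((if (s.rLab p.1) = 3 ∧ (s.bLab p.1) = 0 then (1 : ℤ) else 0) * phi (a - 3) 3 (t.rLab p.2) (t.bLab p.2))
      + (6 : ℤ) * ((if (s.rLab p.1) = 3 ∧ (s.bLab p.1) = 1 then (1 : ℤ) else 0) * phi (a - 3) 2 (t.rLab p.2) (t.bLab p.2))
      + (4 : ℤ) * ((if (s.rLab p.1) = 3 ∧ (s.bLab p.1) = 2 then (1 : ℤ) else 0) * phi (a - 3) 1 (t.rLab p.2) (t.bLab p.2))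
      + (2 : ℤ) * ((if (s.rLab p.1) = 3 ∧ (s.bLab p.1) = 3 then (1 : ℤ) else 0) * phi (a - 3) 0 (t.rLab p.2) (t.bLab p.2))
      + (2 : ℤ) * ((if (s.rLab p.1) = 3 ∧ 6 ≤ (s.bLab p.1) then (1 : ℤ) else 0) * phi (a - 3) 0 (t.rLab p.2) (t.bLab p.2))
      + (6 : ℤ) * ((if (s.rLab p.1) = 4 ∧ (s.bLab p.1) = 0 then (1 : ℤ) else 0) * phi (a - 4) 3 (t.rLab p.2) (t.bLab p.2))
      + (6 : ℤ) * ((if (s.rLab p.1) = 4 ∧ (s.bLab p.1) = 1 then (1 : ℤ) else 0) * phi (a - 4) 2 (t.rLab p.2) (t.bLab p.2))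
      + (2 : ℤ) * ((if (s.rLab p.1) = 4 ∧ (s.bLab p.1) = 2 then (1 : ℤ) else 0) * phi (a - 3) 1 (t.rLab p.2) (t.bLab p.2))
      + (2 : ℤ) * ((if (s.rLab p.1) = 4 ∧ (s.bLab p.1) = 2 then (1 : ℤ) else 0) * phi (a - 4) 1 (t.rLab p.2) (t.bLab p.2))
      + (2 : ℤ) * ((if (s.rLab p.1) = 4 ∧ (s.bLab p.1) = 3 then (1 : ℤ) else 0) * phi (a - 4) 0 (t.rLab p.2) (t.bLab p.2))
      + (5 : ℤ) * ((if (s.rLab p.1) + 4 = a ∧ (s.bLab p.1) = 0 then (1 : ℤ) else 0) * ((if (t.bLab p.2) = 2 ∧ 4 ≤ (t.rLab p.2) then (1 : ℤ) else 0) - (if (t.rLab p.2) = 2 ∧ 4 ≤ (t.bLab p.2) then (1 : ℤ) else 0)))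
      + (5 : ℤ) * ((if 5 ≤ (s.rLab p.1) ∧ (s.rLab p.1) + 5 ≤ a ∧ (s.bLab p.1) = 0 then (1 : ℤ) else 0) * ((if 2 ≤ (t.bLab p.2) ∧ 4 ≤ (t.rLab p.2) then (1 : ℤ) else 0) - (if 2 ≤ (t.rLab p.2) ∧ 4 ≤ (t.bLab p.2) then (1 : ℤ) else 0)))
      + (4 : ℤ) * (phi 4 2 (s.rLab p.1) (s.bLab p.1) * phi (a - 3) 0 (t.rLab p.2) (t.bLab p.2))
      + (6 : ℤ) * ((if (t.rLab p.2) = 0 ∧ (t.bLab p.2) = 3 then (1 : ℤ) else 0) * phi a 0 (s.rLab p.1) (s.bLab p.1))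
      + (6 : ℤ) * ((if (t.rLab p.2) = 0 ∧ (t.bLab p.2) = 2 then (1 : ℤ) else 0) * phi a 1 (s.rLab p.1) (s.bLab p.1))
      + (6 : ℤ) * ((if (t.rLab p.2) = 0 ∧ (t.bLab p.2) = 1 then (1 : ℤ) else 0) * phi a 2 (s.rLab p.1) (s.bLab p.1))
      + (6 : ℤ) * ((if (t.rLab p.2) = 0 ∧ (t.bLab p.2) = 0 then (1 : ℤ) else 0) * phi a 3 (s.rLab p.1) (s.bLab p.1))
      + (6 : ℤ) * ((if (t.rLab p.2) = 1 ∧ (t.bLab p.2) = 3 then (1 : ℤ) else 0) * phi (a - 1) 0 (s.rLab p.1) (s.bLab p.1))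
      + (6 : ℤ) * ((if (t.rLab p.2) = 1 ∧ (t.bLab p.2) = 2 then (1 : ℤ) else 0) * phi (a - 1) 1 (s.rLab p.1) (s.bLab p.1))
      + (6 : ℤ) * ((if (t.rLab p.2) = 1 ∧ (t.bLab p.2) = 1 then (1 : ℤ) else 0) * phi (a - 1) 2 (s.rLab p.1) (s.bLab p.1))
      + (6 : ℤ) * ((if (t.rLab p.2) = 1 ∧ (t.bLab p.2) = 0 then (1 : ℤ) else 0) * phi (a - 1) 3 (s.rLab p.1) (s.bLab p.1))
      + (6 : ℤ) * ((if (t.rLab p.2) = 2 ∧ (t.bLab p.2) = 3 then (1 : ℤ) else 0) * phi (a - 2) 0 (s.rLab p.1) (s.bLab p.1))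
      + (5 : ℤ) * ((if (t.rLab p.2) = 2 ∧ (t.bLab p.2) = 4 then (1 : ℤ) else 0) * phi (a - 2) 0 (s.rLab p.1) (s.bLab p.1))
      + (5 : ℤ) * ((if (t.rLab p.2) = 2 ∧ (t.bLab p.2) = 5 then (1 : ℤ) else 0) * phi (a - 2) 0 (s.rLab p.1) (s.bLab p.1))
      + (5 : ℤ) * ((if (t.rLab p.2) = 2 ∧ 6 ≤ (t.bLab p.2) then (1 : ℤ) else 0) * phi (a - 2) 0 (s.rLab p.1) (s.bLab p.1))
      + (6 : ℤ) * ((if (t.rLab p.2) = 2 ∧ (t.bLab p.2) = 2 then (1 : ℤ) else 0) * phi (a - 2) 1 (s.rLab p.1) (s.bLab p.1))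
      + (if (t.rLab p.2) = 2 ∧ (t.bLab p.2) = 4 then (1 : ℤ) else 0) * phi (a - 2) 1 (s.rLab p.1) (s.bLab p.1)
      + (if (t.rLab p.2) = 2 ∧ (t.bLab p.2) = 5 then (1 : ℤ) else 0) * phi (a - 2) 1 (s.rLab p.1) (s.bLab p.1)
      + (if (t.rLab p.2) = 2 ∧ 6 ≤ (t.bLab p.2) then (1 : ℤ) else 0) * phi (a - 2) 1 (s.rLab p.1) (s.bLab p.1)
      + (6 : ℤ) * ((if (t.rLab p.2) = 2 ∧ (t.bLab p.2) = 1 then (1 : ℤ) else 0) * phi (a - 2) 2 (s.rLab p.1) (s.bLab p.1))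
      + (6 : ℤ) * ((if (t.rLab p.2) = 2 ∧ (t.bLab p.2) = 0 then (1 : ℤ) else 0) * phi (a - 2) 3 (s.rLab p.1) (s.bLab p.1))
      + (if (t.rLab p.2) = 3 ∧ (t.bLab p.2) = 3 then (1 : ℤ) else 0) * phi (a - 3) 0 (s.rLab p.1) (s.bLab p.1)
      + (if (t.rLab p.2) = 3 ∧ 6 ≤ (t.bLab p.2) then (1 : ℤ) else 0) * phi (a - 3) 0 (s.rLab p.1) (s.bLab p.1)
      + (5 : ℤ) * (phi (a - 3) 0 (s.rLab p.1) (s.bLab p.1) * phi 4 2 (t.rLab p.2) (t.bLab p.2))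
      + phi (a - 3) 1 (s.rLab p.1) (s.bLab p.1) * ((if (t.bLab p.2) = 2 ∧ 6 ≤ (t.rLab p.2) then (1 : ℤ) else 0) - (if (t.rLab p.2) = 2 ∧ 6 ≤ (t.bLab p.2) then (1 : ℤ) else 0))
      + (4 : ℤ) * (phi (a - 3) 1 (s.rLab p.1) (s.bLab p.1) * ((if (t.bLab p.2) = 2 ∧ 3 ≤ (t.rLab p.2) then (1 : ℤ) else 0) - (if (t.rLab p.2) = 2 ∧ 3 ≤ (t.bLab p.2) then (1 : ℤ) else 0)))
      + (4 : ℤ) * ((if (t.rLab p.2) = 2 ∧ (t.bLab p.2) = 3 then (1 : ℤ) else 0) * phi (a - 3) 1 (s.rLab p.1) (s.bLab p.1))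
      + (3 : ℤ) * ((if (t.rLab p.2) = 2 ∧ (t.bLab p.2) = 4 then (1 : ℤ) else 0) * phi (a - 3) 1 (s.rLab p.1) (s.bLab p.1))
      + (3 : ℤ) * ((if (t.rLab p.2) = 2 ∧ (t.bLab p.2) = 5 then (1 : ℤ) else 0) * phi (a - 3) 1 (s.rLab p.1) (s.bLab p.1))
      + (4 : ℤ) * ((if (t.rLab p.2) = 2 ∧ 6 ≤ (t.bLab p.2) then (1 : ℤ) else 0) * phi (a - 3) 1 (s.rLab p.1) (s.bLab p.1))
      + (2 : ℤ) * ((if (t.rLab p.2) = 3 ∧ (t.bLab p.2) = 2 then (1 : ℤ) else 0) * phi (a - 3) 1 (s.rLab p.1) (s.bLab p.1))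
      + (if (t.rLab p.2) = 4 ∧ (t.bLab p.2) = 2 then (1 : ℤ) else 0) * phi (a - 3) 1 (s.rLab p.1) (s.bLab p.1)
      + (6 : ℤ) * ((if (t.rLab p.2) = 3 ∧ (t.bLab p.2) = 1 then (1 : ℤ) else 0) * phi (a - 3) 2 (s.rLab p.1) (s.bLab p.1))
      + (6 : ℤ) * ((if (t.rLab p.2) = 3 ∧ (t.bLab p.2) = 0 then (1 : ℤ) else 0) * phi (a - 3) 3 (s.rLab p.1) (s.bLab p.1))
      + phi (a - 4) 0 (s.rLab p.1) (s.bLab p.1) * ((if (t.bLab p.2) = 3 ∧ 6 ≤ (t.rLab p.2) then (1 : ℤ) else 0) - (if (t.rLab p.2) = 3 ∧ 6 ≤ (t.bLab p.2) then (1 : ℤ) else 0))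
      + (if (t.rLab p.2) = 4 ∧ (t.bLab p.2) = 3 then (1 : ℤ) else 0) * phi (a - 4) 0 (s.rLab p.1) (s.bLab p.1)
      + (if (t.rLab p.2) = 4 ∧ (t.bLab p.2) = 2 then (1 : ℤ) else 0) * phi (a - 4) 1 (s.rLab p.1) (s.bLab p.1)
      + (2 : ℤ) * (phi (a - 4) 2 (s.rLab p.1) (s.bLab p.1) * ((if (t.bLab p.2) = 1 ∧ 6 ≤ (t.rLab p.2) then (1 : ℤ) else 0) - (if (t.rLab p.2) = 1 ∧ 6 ≤ (t.bLab p.2) then (1 : ℤ) else 0)))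
      + (2 : ℤ) * ((if (t.rLab p.2) = 1 ∧ 6 ≤ (t.bLab p.2) then (1 : ℤ) else 0) * phi (a - 4) 2 (s.rLab p.1) (s.bLab p.1))
      + (6 : ℤ) * ((if (t.rLab p.2) = 4 ∧ (t.bLab p.2) = 1 then (1 : ℤ) else 0) * phi (a - 4) 2 (s.rLab p.1) (s.bLab p.1))
      + (6 : ℤ) * ((if (t.rLab p.2) = 4 ∧ (t.bLab p.2) = 0 then (1 : ℤ) else 0) * phi (a - 4) 3 (s.rLab p.1) (s.bLab p.1))
      ≤ (6 : ℤ) * phi a 3 ((V2Closure.SP.par s t).rLab p) ((V2Closure.SP.par s t).bLab p) :=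
    fun p => phi_col3_par_ge a (s.rLab p.1) (s.bLab p.1) (t.rLab p.2) (t.bLab p.2) ha
  have hD : 0 ≤ ∑ p : s.Conf × t.Conf, (6 : ℤ) * phi a 3 ((V2Closure.SP.par s t).rLab p) ((V2Closure.SP.par s t).bLab p) := by
    calc (0 : ℤ) ≤ _ := add_nonneg (g0) g1
      _ = ∑ p : s.Conf × t.Conf, (_ + _ + _ + _ + _ + _ + _ + _ + _ + _ + _ + _ + _ + _ + _ + _ + _ + _ + _ + _ + _ + _ + _ + _ + _ + _ + _ + _ + _ + _ + _ + _ + _ + _ + _ + _ + _ + _ + _ + _ + _ + _ + _ + _ + _ + _ + _ + _ + _ + _ + _ + _ + _ + _ + _ + _ + _ + _ + _ + _ + _ + _ + _ + _ + _ + _ + _ + _ + _ + _ + _ + _ + _ + _ + _ + _ + _ + _ + _ + _ + _ + _ + _ + _ + _ + _ + _ + _ + _ + _ + _ + _ + _ + _ + _ + _ + _ + _ + _ + _ + _ + _ + _ + _ + _ + _ + _ + _ + _ + _ + _ + _ + _ + _) := by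
        simp only [← Finset.sum_add_distrib]
        exact Finset.sum_congr rfl (fun p _ => by abel)
      _ ≤ ∑ p : s.Conf × t.Conf, (6 : ℤ) * phi a 3 ((V2Closure.SP.par s t).rLab p) ((V2Closure.SP.par s t).bLab p) :=
          Finset.sum_le_sum (fun p _ => key p)
  rw [← Finset.mul_sum] at hD
  exact le_of_mul_le_mul_left (by rw [mul_zero]; exact hD) (by norm_num : (0 : ℤ) < 6)

end Product

/-- **the whole column `j = 3` on every pattern of the grammar**: `a` edge-disjoint red paths together
with `3` edge-disjoint blue paths are rarer than `a−1` red paths together with `4` blue paths, for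
EVERY `a ≥ 5`: `T(a,3) ≤ T(a−1,4)`. -/
theorem t_col3 : ∀ (s : V2Closure.SP) (a : ℕ), 5 ≤ a →
    (Finset.univ.filter (fun y : s.Conf => a ≤ s.rLab y ∧ 3 ≤ s.bLab y)).card
      ≤ (Finset.univ.filter (fun y : s.Conf => a - 1 ≤ s.rLab y ∧ 4 ≤ s.bLab y)).card
  | .free, a, ha => offaxis_atom .free (Or.inl rfl) a 3 (by omega)
  | .pin, a, ha => offaxis_atom .pin (Or.inr (Or.inl rfl)) a 3 (by omega)
  | .absent, a, ha => offaxis_atom .absent (Or.inr (Or.inr rfl)) a 3 (by omega)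
  | .ser s t, a, ha => by
    rw [card_tail_ser, card_tail_ser]
    exact Nat.mul_le_mul (t_col3 s a ha) (t_col3 t a ha)
  | .par s t, a, ha => by
    rcases (by omega : a = 5 ∨ a = 6 ∨ a = 7 ∨ a = 8 ∨ a = 9 ∨ 10 ≤ a) with
      rfl | rfl | rfl | rfl | rfl | h10
    · exact t53_le_t44 (.par s t)
    · exact t63_le_t54 (.par s t)
    · exact t73_le_t64 (.par s t)
    · exact t83_le_t74 (.par s t)
    · exact t93_le_t84 (.par s t)
    · exact (offaxis_iff (.par s t) a 3 (by omega)).2 (sum_phi_col3_par s t a (by omega)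
        (fun m hm hma => (offaxis_iff s m 3 (by omega)).1 (t_col3 s m hm))
        (fun m hm hma => (offaxis_iff t m 3 (by omega)).1 (t_col3 t m hm)))

/-- the same in the vocabulary of `Tail2DP2Series` -/
theorem stat_t_col3 (s : V2Closure.SP) (a : ℕ) (ha : 5 ≤ a) :
    stat s (fun r b => a ≤ r ∧ 3 ≤ b) ≤ stat s (fun r b => a - 1 ≤ r ∧ 4 ≤ b) :=
  t_col3 s a ha

/-- the count form: `0 ≤ Σ phi a 3` on every pattern for every `a ≥ 5` -/
theorem SP.sum_phi_col3_nonneg (s : V2Closure.SP) (a : ℕ) (ha : 5 ≤ a) :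
    0 ≤ ∑ x, phi a 3 (s.rLab x) (s.bLab x) :=
  (offaxis_iff s a 3 (by omega)).1 (t_col3 s a ha)

/-- a member beyond the landed ones in their form, e.g. `T(11,3) ≤ T(10,4)` -/
theorem t113_le_t104 (s : V2Closure.SP) :
    (Finset.univ.filter (fun y : s.Conf => 11 ≤ s.rLab y ∧ 3 ≤ s.bLab y)).card
      ≤ (Finset.univ.filter (fun y : s.Conf => 10 ≤ s.rLab y ∧ 4 ≤ s.bLab y)).card :=
  t_col3 s 11 (by norm_num)

end Summit.Ventures.PercRepro2.Tail2D
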